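import Summits.RiemannHypothesis.RiemannHypothesis.Theorems.ScrewManifestFactorRichLags
import Summits.RiemannHypothesis.RiemannHypothesis.Theorems.ScrewManifestCornerPrelims
import Summits.RiemannHypothesis.RiemannHypothesis.Theorems.ScrewManifestAtomSumBounds
import HarnessLib

/-!
# RH-FREE: the WEAK J-BOUND `wJ·N ≤ 30·log N + 330` for EVERY strictly-DD manifest remainder (any height)

sos-theory note 3 (SCREW-P3-PLATEAU-NOTE-g20 §4), in a CRT-free form.  Let `R = S_N − Σ_k w_k A_{t_k} − wJ·J`
(`w_k ≥ 0`, arbitrary frequencies, `N = n + 1 ≥ 60`) be STRICTLY diagonally dominant.  Take the node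
`m = 12k ≤ N − 6` closest to the top; its four neighbours `m ± 4 = 4(3k ± 1)` and `m ± 6 = 6(2k ± 1)` are
AUTOMATICALLY factor-rich, as is `m`.  On factor-rich rows the divisor-pair identity gives `R_ii > 2wJ/3`
(`diag_bounds_of_factorRich`), so by `remainder_offdiag_eq` and `η ≤ Ψ` each of the four entries satisfies
`R_{m,m'} ≥ (R_mm + R_m'm')/2 − Ψ(lag) > (2/3)wJ − Ψ(lag)`, while the scaled lags lie in `[1, 10]` where the
cusp bound `|N·Ψ(s/N) − (s/2)log N| ≤ 55` (`abs_mul_zetaScrew_div_sub_le_ten`) gives `N·Ψ(lag) ≤ 5 log N + 55`.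
Summing the four inside the row budget `Σ_{j≠m}|R_mj| < R_mm < 2wJ`:
`(8/3)wJ·N − 20 log N − 220 < 2wJ·N`, i.e.

* `weakJBound` : `wJ·(n+1) ≤ 30·log(n+1) + 330` — the first RH-free bound on a certificate scalar that is
  UNIFORM IN THE HEIGHT (what remains of S2a `JBound` is `O(log N) → O(1)`).

RH-FREE statements about the certificate FORMAT; nothing here bears on the truth of RH.  References:
[folklore]; plan: sos-theory note 3 §4.
-/

set_option linter.dupNamespace false
set_option autoImplicit false

noncomputable section

open Real Set Finset

namespace Summit.RiemannHypothesis.RiemannHypothesis.Theorems.IntegerScrew.Manifest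

open Literature.NumberTheory.LFunctions

/-- **Uniform scaled cusp up to `s = 10`.** For `1 ≤ s ≤ 10` and `M ≥ 20`:
`|M·Ψ(s/M) − (s/2)·log M| ≤ 55` (`6s²/M ≤ 30`, `(s/2)·log s ≤ 15`, `|c|·s ≤ 10`). [folklore] -/
theorem abs_mul_zetaScrew_div_sub_le_ten {s M : ℝ} (hs1 : 1 ≤ s) (hs10 : s ≤ 10) (hM : 20 ≤ M) :
    |M * zetaScrew (s / M) - s / 2 * Real.log M| ≤ 55 := by
  have hM0 : 0 < M := by linarith
  have hs0 : 0 < s := by linarith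
  have ht0 : 0 < s / M := by positivity
  have ht2 : s / M ≤ 1 / 2 := by
    rw [div_le_div_iff₀ hM0 (by norm_num)]; linarith
  set c := (1 - Real.eulerMascheroniConstant - Real.log (2 * Real.pi)) / 2 with hc
  have hcusp := abs_zetaScrew_sub_cusp_le ht0 ht2
  rw [← hc] at hcusp
  have hcabs : |c| ≤ 1 := abs_cuspConst_le_one
  have hlog : Real.log (1 / (s / M)) = Real.log M - Real.log s := by
    rw [one_div, Real.log_inv, Real.log_div hs0.ne' hM0.ne']; ring
  rw [hlog] at hcusp
  have hmul : |M * zetaScrew (s / M) - (s / 2 * (Real.log M - Real.log s) + c * s)|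
      ≤ 6 * s ^ 2 / M := by
    have e : M * zetaScrew (s / M) - (s / 2 * (Real.log M - Real.log s) + c * s)
        = M * (zetaScrew (s / M) - (s / M / 2 * (Real.log M - Real.log s) + c * (s / M))) := by
      field_simp
    rw [e, abs_mul, abs_of_pos hM0]
    have h := mul_le_mul_of_nonneg_left hcusp hM0.le
    have e2 : M * (6 * (s / M) ^ 2) = 6 * s ^ 2 / M := by field_simp
    rw [e2] at h
    exact h
  have h1 : 6 * s ^ 2 / M ≤ 30 := by
    rw [div_le_iff₀ hM0]; nlinarith
  have hlogs0 : 0 ≤ Real.log s := Real.log_nonneg hs1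
  have hlogs : Real.log s ≤ 3 := by
    have he := Real.exp_one_gt_d9
    have h3 : s ≤ Real.exp 3 := by
      have e : Real.exp 3 = Real.exp 1 * Real.exp 1 * Real.exp 1 := by
        rw [← Real.exp_add, ← Real.exp_add]; norm_num
      rw [e]; nlinarith [mul_pos (Real.exp_pos 1) (Real.exp_pos 1)]
    exact (Real.log_le_iff_le_exp hs0).mpr h3
  have h2 : |s / 2 * Real.log s| ≤ 15 := by
    rw [abs_of_nonneg (by positivity)]; nlinarith
  have h3 : |c * s| ≤ 10 := by
    rw [abs_mul, abs_of_pos hs0]; nlinarith [abs_nonneg c]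
  have e3 : M * zetaScrew (s / M) - s / 2 * Real.log M
      = (M * zetaScrew (s / M) - (s / 2 * (Real.log M - Real.log s) + c * s))
        - s / 2 * Real.log s + c * s := by ring
  rw [e3]
  have t1 := abs_add_le ((M * zetaScrew (s / M) - (s / 2 * (Real.log M - Real.log s) + c * s))
      - s / 2 * Real.log s) (c * s)
  have t2 := abs_sub (M * zetaScrew (s / M) - (s / 2 * (Real.log M - Real.log s) + c * s))
      (s / 2 * Real.log s)
  linarith

/-- The four neighbours `12k ± 4 = 4(3k ± 1)` of a multiple of `12` (`k ≥ 2`) are factor-rich. [folklore] -/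
theorem factorRich_twelve_mul_pm_four (k : ℕ) (hk : 2 ≤ k) :
    FactorRich (12 * k - 4) ∧ FactorRich (12 * k + 4) :=
  ⟨⟨2, 6 * k - 2, 4, 3 * k - 1, by omega⟩, ⟨2, 6 * k + 2, 4, 3 * k + 1, by omega⟩⟩

/-- The four neighbours `12k ± 6 = 6(2k ± 1)` of a multiple of `12` (`k ≥ 2`) are factor-rich. [folklore] -/
theorem factorRich_twelve_mul_pm_six (k : ℕ) (hk : 2 ≤ k) :
    FactorRich (12 * k - 6) ∧ FactorRich (12 * k + 6) :=
  ⟨⟨2, 6 * k - 3, 3, 4 * k - 2, by omega⟩, ⟨2, 6 * k + 3, 3, 4 * k + 2, by omega⟩⟩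

/-- `η ≤ Ψ`: the profile of a decomposition with nonnegative weights lies below the screw function. [folklore] -/
theorem remainderFn_le_zetaScrew (K : ℕ) (t w : Fin K → ℝ) (hw : ∀ k, 0 ≤ w k) (u : ℝ) :
    remainderFn K t w u ≤ zetaScrew u := by
  unfold remainderFn
  have : 0 ≤ ∑ k, w k * ((1 - Real.cos (t k * u)) / t k ^ 2) :=
    sum_nonneg fun k _ => mul_nonneg (hw k) (cosAtom_nonneg _ _)
  linarith

/-- Four distinct terms of a nonnegative sum. [folklore] -/
theorem add_four_le_sum {n : ℕ} (f : Fin n → ℝ) (s : Finset (Fin n)) (hf : ∀ j, 0 ≤ f j)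
    (a b c d : Fin n) (ha : a ∈ s) (hb : b ∈ s) (hc : c ∈ s) (hd : d ∈ s)
    (hab : a ≠ b) (hac : a ≠ c) (had : a ≠ d) (hbc : b ≠ c) (hbd : b ≠ d) (hcd : c ≠ d) :
    f a + f b + f c + f d ≤ ∑ j ∈ s, f j := by
  have hsub : ({a, b, c, d} : Finset (Fin n)) ⊆ s := by
    intro x hx
    simp only [Finset.mem_insert, Finset.mem_singleton] at hx
    rcases hx with rfl | rfl | rfl | rfl <;> assumption
  have h := Finset.sum_le_sum_of_subset_of_nonneg hsub (fun j _ _ => hf j)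
  rw [Finset.sum_insert (by simp [hab, hac, had]), Finset.sum_insert (by simp [hbc, hbd]),
    Finset.sum_insert (by simp [hcd]), Finset.sum_singleton] at h
  linarith

/-- One neighbour of the budget: for factor-rich rows `i ≠ j` of a strictly-DD manifest remainder with
nonnegative weights, `N·R i j ≥ (2/3)·wJ·N − N·Ψ(node i − node j)`. [folklore] -/
theorem offdiag_lower_of_factorRich (n K : ℕ) (t w : Fin K → ℝ) (wJ : ℝ) (hw : ∀ k, 0 ≤ w k)
    (hD : IsStrictDiagDominant (remainder n K t w wJ)) (i j : Fin n)
    (hi : FactorRich ((i : ℕ) + 2)) (hj : FactorRich ((j : ℕ) + 2)) :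
    2 / 3 * wJ - zetaScrew (node n i - node n j) ≤ remainder n K t w wJ i j := by
  have e := remainder_offdiag_eq n K t w wJ i j
  have h1 := (diag_bounds_of_factorRich n K t w wJ hD i hi).2
  have h2 := (diag_bounds_of_factorRich n K t w wJ hD j hj).2
  have h3 := remainderFn_le_zetaScrew K t w hw (node n i - node n j)
  rw [e]
  linarith

set_option maxHeartbeats 400000 in
/-- **WEAK J-BOUND (RH-free, height-uniform):** for every wave decomposition of `S_{n+1}` with nonnegative
weights (any frequencies, any number of atoms) whose remainder is strictly diagonally dominant, and
`n + 1 ≥ 60`: `wJ·(n+1) ≤ 30·log(n+1) + 330`. [folklore] -/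
theorem weakJBound (n K : ℕ) (t w : Fin K → ℝ) (wJ : ℝ) (hn : 60 ≤ n + 1) (hw : ∀ k, 0 ≤ w k)
    (hD : IsStrictDiagDominant (remainder n K t w wJ)) :
    wJ * ((n : ℝ) + 1) ≤ 30 * Real.log ((n : ℝ) + 1) + 330 := by
  -- the row `m = 12k`, `k = (n − 5)/12`, `N − 17 ≤ m ≤ N − 6`
  set k : ℕ := (n - 5) / 12 with hk
  have hk2 : 2 ≤ k := by omega
  have hmlo : n - 16 ≤ 12 * k := by omega
  have hmhi : 12 * k + 6 ≤ n + 1 := by omega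
  set N : ℝ := (n : ℝ) + 1 with hN
  have hN60 : (60 : ℝ) ≤ N := by rw [hN]; exact_mod_cast hn
  have hN0 : 0 < N := by linarith
  set L : ℝ := Real.log N with hL
  have hL0 : 0 ≤ L := Real.log_nonneg (by linarith)
  -- cusp: `N·Ψ(u) ≤ 5L + 55` whenever the scaled lag `N·u` lies in `[1, 10]`
  have hN20 : (20 : ℝ) ≤ N := by linarith
  have cusp : ∀ u : ℝ, 1 ≤ N * u → N * u ≤ 10 → N * zetaScrew u ≤ 5 * L + 55 := by
    intro u h1 h10
    have h := abs_mul_zetaScrew_div_sub_le_ten h1 h10 hN20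
    rw [mul_div_cancel_left₀ u hN0.ne', ← hL] at h
    have h' := (abs_le.mp h).2
    have h'' : N * u / 2 * L ≤ 5 * L := by
      have := mul_le_mul_of_nonneg_right h10 hL0
      linarith
    linarith
  have hmR : N - 17 ≤ ((12 * k : ℕ) : ℝ) := by
    have : ((n - 16 : ℕ) : ℝ) ≤ ((12 * k : ℕ) : ℝ) := by exact_mod_cast hmlo
    rw [Nat.cast_sub (by omega)] at this
    push_cast at this ⊢
    linarith only [this]
  have hmR' : ((12 * k : ℕ) : ℝ) + 6 ≤ N := by
    have : ((12 * k + 6 : ℕ) : ℝ) ≤ ((n + 1 : ℕ) : ℝ) := by exact_mod_cast hmhi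
    push_cast at this ⊢
    linarith only [this]
  -- the four pairs (row `m`, columns `m − 4`, `m − 6`, `m + 4`, `m + 6`) with their lag brackets
  obtain ⟨i₁, j₁, hi₁, hj₁, hlo₁, hhi₁⟩ := lag_bracket n (12 * k - 4) 4 (by omega) (by omega) (by omega)
  obtain ⟨i₂, j₂, hi₂, hj₂, hlo₂, hhi₂⟩ := lag_bracket n (12 * k - 6) 6 (by omega) (by omega) (by omega)
  obtain ⟨i₃, j₃, hi₃, hj₃, hlo₃, hhi₃⟩ := lag_bracket n (12 * k) 4 (by omega) (by omega) (by omega)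
  obtain ⟨i₄, j₄, hi₄, hj₄, hlo₄, hhi₄⟩ := lag_bracket n (12 * k) 6 (by omega) (by omega) (by omega)
  rw [← hN] at hlo₁ hhi₁ hlo₂ hhi₂ hlo₃ hhi₃ hlo₄ hhi₄
  -- all centre indices are the row `m − 2`
  have e₂ : i₂ = i₁ := Fin.ext (by omega)
  have e₃ : j₃ = i₁ := Fin.ext (by omega)
  have e₄ : j₄ = i₁ := Fin.ext (by omega)
  rw [e₂] at hlo₂ hhi₂
  rw [e₃] at hlo₃ hhi₃
  rw [e₄] at hlo₄ hhi₄
  -- factor-richness of the five nodes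
  have hri : FactorRich ((i₁ : ℕ) + 2) := by
    rw [hi₁, show 12 * k - 4 + 4 - 2 + 2 = 12 * k by omega]; exact factorRich_twelve_mul k (by omega)
  have hrj₁ : FactorRich ((j₁ : ℕ) + 2) := by
    rw [hj₁, show 12 * k - 4 - 2 + 2 = 12 * k - 4 by omega]; exact (factorRich_twelve_mul_pm_four k hk2).1
  have hrj₂ : FactorRich ((j₂ : ℕ) + 2) := by
    rw [hj₂, show 12 * k - 6 - 2 + 2 = 12 * k - 6 by omega]; exact (factorRich_twelve_mul_pm_six k hk2).1
  have hri₃ : FactorRich ((i₃ : ℕ) + 2) := by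
    rw [hi₃, show 12 * k + 4 - 2 + 2 = 12 * k + 4 by omega]; exact (factorRich_twelve_mul_pm_four k hk2).2
  have hri₄ : FactorRich ((i₄ : ℕ) + 2) := by
    rw [hi₄, show 12 * k + 6 - 2 + 2 = 12 * k + 6 by omega]; exact (factorRich_twelve_mul_pm_six k hk2).2
  -- casts of the pair parameters
  have c1 : (((12 * k - 4 : ℕ) : ℝ)) = ((12 * k : ℕ) : ℝ) - 4 := by
    rw [Nat.cast_sub (by omega)]; push_cast; ring
  have c2 : (((12 * k - 6 : ℕ) : ℝ)) = ((12 * k : ℕ) : ℝ) - 6 := by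
    rw [Nat.cast_sub (by omega)]; push_cast; ring
  set m : ℝ := ((12 * k : ℕ) : ℝ) with hm
  have hm0 : 43 ≤ m := by linarith only [hmR, hN60]
  rw [c1] at hlo₁ hhi₁
  rw [c2] at hlo₂ hhi₂
  push_cast at hlo₁ hhi₁ hlo₂ hhi₂ hlo₃ hhi₃ hlo₄ hhi₄
  -- the four scaled lags lie in `[1, 10]`
  have hℓ₁lo : 1 ≤ N * (node n i₁ - node n j₁) := by
    have : (1 : ℝ) ≤ 4 * N / (m - 4 + 4) := by
      rw [le_div_iff₀ (by linarith only [hm0])]; linarith only [hmR', hm0]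
    linarith only [this, hlo₁]
  have hℓ₁hi : N * (node n i₁ - node n j₁) ≤ 10 := by
    have : 4 * N / (m - 4) ≤ 10 := by
      rw [div_le_iff₀ (by linarith only [hm0])]; linarith only [hmR, hN60]
    linarith only [this, hhi₁]
  have hℓ₂lo : 1 ≤ N * (node n i₁ - node n j₂) := by
    have : (1 : ℝ) ≤ 6 * N / (m - 6 + 6) := by
      rw [le_div_iff₀ (by linarith only [hm0])]; linarith only [hmR', hm0]
    linarith only [this, hlo₂]
  have hℓ₂hi : N * (node n i₁ - node n j₂) ≤ 10 := by
    have : 6 * N / (m - 6) ≤ 10 := by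
      rw [div_le_iff₀ (by linarith only [hm0])]; linarith only [hmR, hN60]
    linarith only [this, hhi₂]
  have hℓ₃lo : 1 ≤ N * (node n i₃ - node n i₁) := by
    have : (1 : ℝ) ≤ 4 * N / (m + 4) := by
      rw [le_div_iff₀ (by linarith only [hm0])]; linarith only [hmR', hm0]
    linarith only [this, hlo₃]
  have hℓ₃hi : N * (node n i₃ - node n i₁) ≤ 10 := by
    have : 4 * N / m ≤ 10 := by
      rw [div_le_iff₀ (by linarith only [hm0])]; linarith only [hmR, hN60]
    linarith only [this, hhi₃]
  have hℓ₄lo : 1 ≤ N * (node n i₄ - node n i₁) := by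
    have : (1 : ℝ) ≤ 6 * N / (m + 6) := by
      rw [le_div_iff₀ (by linarith only [hm0])]; linarith only [hmR', hm0]
    linarith only [this, hlo₄]
  have hℓ₄hi : N * (node n i₄ - node n i₁) ≤ 10 := by
    have : 6 * N / m ≤ 10 := by
      rw [div_le_iff₀ (by linarith only [hm0])]; linarith only [hmR, hN60]
    linarith only [this, hhi₄]
  -- cusp: `N·Ψ(lag) ≤ 5L + 55` for each of the four lags
  have hΨ₁ : N * zetaScrew (node n i₁ - node n j₁) ≤ 5 * L + 55 := cusp _ hℓ₁lo hℓ₁hi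
  have hΨ₂ : N * zetaScrew (node n i₁ - node n j₂) ≤ 5 * L + 55 := cusp _ hℓ₂lo hℓ₂hi
  have hΨ₃ : N * zetaScrew (node n i₁ - node n i₃) ≤ 5 * L + 55 := by
    have e : node n i₁ - node n i₃ = -(node n i₃ - node n i₁) := by ring
    rw [e, zetaScrew_neg]
    exact cusp _ hℓ₃lo hℓ₃hi
  have hΨ₄ : N * zetaScrew (node n i₁ - node n i₄) ≤ 5 * L + 55 := by
    have e : node n i₁ - node n i₄ = -(node n i₄ - node n i₁) := by ring
    rw [e, zetaScrew_neg]
    exact cusp _ hℓ₄lo hℓ₄hi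
  -- the four off-diagonal lower bounds, scaled by `N`
  set R := remainder n K t w wJ with hR
  have hb₁ := offdiag_lower_of_factorRich n K t w wJ hw hD i₁ j₁ hri hrj₁
  have hb₂ := offdiag_lower_of_factorRich n K t w wJ hw hD i₁ j₂ hri hrj₂
  have hb₃ := offdiag_lower_of_factorRich n K t w wJ hw hD i₁ i₃ hri hri₃
  have hb₄ := offdiag_lower_of_factorRich n K t w wJ hw hD i₁ i₄ hri hri₄
  rw [← hR] at hb₁ hb₂ hb₃ hb₄
  have g₁ : 2 / 3 * (wJ * N) - (5 * L + 55) ≤ N * |R i₁ j₁| := by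
    have h := mul_le_mul_of_nonneg_left (le_trans hb₁ (le_abs_self _)) hN0.le
    have e : N * (2 / 3 * wJ - zetaScrew (node n i₁ - node n j₁))
        = 2 / 3 * (wJ * N) - N * zetaScrew (node n i₁ - node n j₁) := by ring
    rw [e] at h
    linarith only [h, hΨ₁]
  have g₂ : 2 / 3 * (wJ * N) - (5 * L + 55) ≤ N * |R i₁ j₂| := by
    have h := mul_le_mul_of_nonneg_left (le_trans hb₂ (le_abs_self _)) hN0.le
    have e : N * (2 / 3 * wJ - zetaScrew (node n i₁ - node n j₂))
        = 2 / 3 * (wJ * N) - N * zetaScrew (node n i₁ - node n j₂) := by ring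
    rw [e] at h
    linarith only [h, hΨ₂]
  have g₃ : 2 / 3 * (wJ * N) - (5 * L + 55) ≤ N * |R i₁ i₃| := by
    have h := mul_le_mul_of_nonneg_left (le_trans hb₃ (le_abs_self _)) hN0.le
    have e : N * (2 / 3 * wJ - zetaScrew (node n i₁ - node n i₃))
        = 2 / 3 * (wJ * N) - N * zetaScrew (node n i₁ - node n i₃) := by ring
    rw [e] at h
    linarith only [h, hΨ₃]
  have g₄ : 2 / 3 * (wJ * N) - (5 * L + 55) ≤ N * |R i₁ i₄| := by
    have h := mul_le_mul_of_nonneg_left (le_trans hb₄ (le_abs_self _)) hN0.le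
    have e : N * (2 / 3 * wJ - zetaScrew (node n i₁ - node n i₄))
        = 2 / 3 * (wJ * N) - N * zetaScrew (node n i₁ - node n i₄) := by ring
    rw [e] at h
    linarith only [h, hΨ₄]
  -- the row budget: the four columns are distinct members of `univ.erase i₁`, and `Σ < R i₁ i₁ < 2wJ`
  have hfour := add_four_le_sum (fun j => |R i₁ j|) (univ.erase i₁) (fun _ => abs_nonneg _)
    j₁ j₂ i₃ i₄
    (mem_erase.mpr ⟨fun h => by have := congrArg Fin.val h; omega, mem_univ _⟩)
    (mem_erase.mpr ⟨fun h => by have := congrArg Fin.val h; omega, mem_univ _⟩)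
    (mem_erase.mpr ⟨fun h => by have := congrArg Fin.val h; omega, mem_univ _⟩)
    (mem_erase.mpr ⟨fun h => by have := congrArg Fin.val h; omega, mem_univ _⟩)
    (fun h => by have := congrArg Fin.val h; omega) (fun h => by have := congrArg Fin.val h; omega)
    (fun h => by have := congrArg Fin.val h; omega) (fun h => by have := congrArg Fin.val h; omega)
    (fun h => by have := congrArg Fin.val h; omega) (fun h => by have := congrArg Fin.val h; omega)
  have hrow := hD i₁
  have hdiag := (diag_bounds_of_factorRich n K t w wJ hD i₁ hri).1
  rw [← hR] at hdiag
  have hsumN : N * (|R i₁ j₁| + |R i₁ j₂| + |R i₁ i₃| + |R i₁ i₄|) < N * (2 * wJ) :=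
    mul_lt_mul_of_pos_left (lt_of_le_of_lt hfour (lt_trans hrow hdiag)) hN0
  have e1 : N * (|R i₁ j₁| + |R i₁ j₂| + |R i₁ i₃| + |R i₁ i₄|)
      = N * |R i₁ j₁| + N * |R i₁ j₂| + N * |R i₁ i₃| + N * |R i₁ i₄| := by ring
  have e2 : N * (2 * wJ) = 2 * (wJ * N) := by ring
  rw [e1, e2] at hsumN
  linarith only [hsumN, g₁, g₂, g₃, g₄]

end Summit.RiemannHypothesis.RiemannHypothesis.Theorems.IntegerScrew.Manifest

end
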